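import Summits.BirchSwinnertonDyer.Rank1Residual.ManinAdditive.MinusOneLevelRaising
import Summits.BirchSwinnertonDyer.BirchSwinnertonDyer.Theorems.ManinLocalTwoThreeLevelRaisingPeriodLattice
import HarnessLib

/-!
# E-an-145 `MinusOneLevelRaisingLatticeRotation` and E-an-145R `MinusOneLevelRaisingOptimalOrbit` are THEOREMS
# (cell `bsd-f2-manin`, seat -an gen 32, MEMO-an §75.7; proof file for the nodes of `MinusOneLevelRaising.lean`; TURNKEY-an-22 B1)

BY NAME.  E-an-145 (`4 ∣ N(W)`, `N(W′) = 4N(W)`, `W ⊗ χ₋₄ ~ W′`, any `Γ₀`-data: `z ∈ Λ(f_{W′}) ↔ i z ∈ Λ(f_W)`):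
statement and paper proof (MEMO-an §75.3: even coefficients vanish, `f ⊗ χ₋₄ = −i·f|T_{1/4}`, S-an-56 «the period
lattice does not shrink from `Γ₀(N)` to `Γ₀(4N)` when `2 ∣ N`», two-sided half-Gauss-sum step) are the -an seat's
(g32; kernel-certified scratch HOME/an/g32/MinusOneLevelRaisingAll.lean 6e04a7a1edf1d79f, farm rc 0 · 0 err · 0 warn ·
0 sorry, axioms standard — an g32 and independently ref1 §R122); the Lean BODY of the rotation and S-an-56 were landed
by the width prover p2 g13 as `Theorems/ManinLocalTwoThreeLevelRaisingPeriodLattice.lean` (p693677: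
`ManinLocalTwoThree.periodLattice_le_periodLattice_charTwist_one_of_two_dvd`,
`ManinLocalTwoThree.half_gaussSum_χ₄_mul_mem_periodLattice_twoSided_levelRaising`,
`ManinLocalTwoThree.mem_periodLattice_iff_I_mul_mem_of_levelRaising`), so §3 here is the one-line discharge of the
node over p2's theorem (an's own B1 HOME/an/g32/MinusOneLevelRaisingProof.lean d03828f976afb11a re-proved the same
two-sided step and bounced `dedup.landed` at the typer's dry-run; its §1–§2 variant of S-an-56 for equal modular
symbols, `periodLattice_le_of_modularSymbol_eq`, is not landed).  §4 is an's B1 §4 VERBATIM: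
`minusOneLevelRaisingOptimalOrbit_holds` (E-an-145R: optimality commutes and `c′ = ±c`, via the landed
`minusOneLevelRaisingOptimalOrbit_of_rotation`) and `levelRaising_two_not_dvd_c_iff` (`2 ∤ c ⟺ 2 ∤ c′`, both ways,
unconditionally).  PART B2 (E-an-145D proved, S-an-57 typed, the `4 ∥ N` stratum reduction) is the sibling
`MinusOneLevelRaisingDegreeProof.lean`.  No new `Prop` is introduced; every declaration is a kernel theorem.
Nothing here is BSD; C2 (`ManinOddAtFour`) stays OPEN — this makes its `v₂(N) = 2` stratum and the `χ₋₄`-image of that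
stratum at `v₂(N) = 4` EQUIVALENT.  REFUTER: R-an-57 (ref1 §R122) pre-landing CLEAN; by-name `--axioms` owed.
bears_on: stmt-BirchSwinnertonDyer-22967 (C2).  (typer g17)
[cite: Stevens1989, Lemma (5.4) p. 97] [cite: Cremona1997, §2.8 (period lattice over Γ₀(N))]
-/

noncomputable section

open scoped MatrixGroups ModularForm

open CongruenceSubgroup WeierstrassCurve
  Literature.NumberTheory.DiophantineGeometry
  Literature.NumberTheory.EllipticCurves
  Literature.NumberTheory.EllipticCurves.ModularForms
  Summit.BirchSwinnertonDyer.BirchSwinnertonDyer.Theorems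

namespace Summit.BirchSwinnertonDyer.Rank1Residual.ManinAdditive

section LevelRaisingRotation

/-! ## §3 E-an-145 `MinusOneLevelRaisingLatticeRotation` PROVED (by name, over p2's landed body) -/

/-- **E-an-145 is a THEOREM**: on every level-raising `χ₋₄`-pair (`4 ∣ N(W)`, `N(W′) = 4·N(W)`, `W ⊗ χ₋₄ ~ W′`;
`D`, `D′` any `Γ₀`-data at the conductors), `z ∈ Λ(f′) ⟺ i·z ∈ Λ(f)` — the node of `MinusOneLevelRaising.lean`
discharged by p2's `ManinLocalTwoThree.mem_periodLattice_iff_I_mul_mem_of_levelRaising` (the global-minimality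
binders of the node are not used). -/
theorem minusOneLevelRaisingLatticeRotation_holds : MinusOneLevelRaisingLatticeRotation := by
  intro W W' _ _ _ _ _ _ D D' h4 hN hiso z
  exact ManinLocalTwoThree.mem_periodLattice_iff_I_mul_mem_of_levelRaising D D' h4 hN hiso z

end LevelRaisingRotation

section Corollaries

/-! ## §4 E-an-145R and the `2 ∤ c` transport both ways are THEOREMS -/

/-- **E-an-145R is a THEOREM**: on the level-raising `χ₋₄`-orbit (`4 ∣ N(W)`, `N(W′) = 4N(W)`, both data
lattice-optimal) optimality COMMUTES (`W′ ≅ W ⊗ χ₋₄` over `ℚ`) and `c′ = ±c`. -/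
theorem minusOneLevelRaisingOptimalOrbit_holds : MinusOneLevelRaisingOptimalOrbit :=
  minusOneLevelRaisingOptimalOrbit_of_rotation minusOneLevelRaisingLatticeRotation_holds

/-- `2 ∤ c` downstairs `⟺` `2 ∤ c′` upstairs, unconditionally. -/
theorem levelRaising_two_not_dvd_c_iff {W W' : WeierstrassCurve ℚ} [W.IsElliptic] [W.IsGloballyMinimal]
    [W'.IsElliptic] [W'.IsGloballyMinimal] [NeZero (W.conductorNorm ℤ)] [NeZero (W'.conductorNorm ℤ)]
    (D : ModularParametrizationData W (W.conductorNorm ℤ))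
    (D' : ModularParametrizationData W' (W'.conductorNorm ℤ)) (hD : IsLatticeOptimal D)
    (hD' : IsLatticeOptimal D') (h4 : 2 ^ 2 ∣ W.conductorNorm ℤ)
    (hN : W'.conductorNorm ℤ = 4 * W.conductorNorm ℤ)
    (hiso : IsIsogenous (W.quadraticTwist ((-1 : ℤ) : ℚ)) W') :
    ¬ (2 : ℤ) ∣ D.c ↔ ¬ (2 : ℤ) ∣ D'.c :=
  two_not_dvd_c_iff_of_levelRaising minusOneLevelRaisingOptimalOrbit_holds W W' D D' hD hD' h4 hN hiso

end Corollaries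

end Summit.BirchSwinnertonDyer.Rank1Residual.ManinAdditive
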